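import Summits.BirchSwinnertonDyer.BirchSwinnertonDyer.Theorems.AdditiveBranchIMCGordTwoRankOneUnitSlice
import Summits.BirchSwinnertonDyer.BirchSwinnertonDyer.Theorems.AdditiveBranchIMCGordTwoRankOneSplitGlue
import HarnessLib

/-!
# Route `AdditiveBranchIMC` (rung K1), crux `GordTwoRankOne` (item 19358) BY NAME, reduced to its CONTENT rows
# `¬ BranchUnitCoeffAt W p 1` (`v_p(A′) ≥ 1` or `A′ = 0`) — sequel of `…GordTwoRankOneUnitSlice.lean`
# (cell `bsd-addord`, seat `bsd-addord-k1-c3` gen 4, D-0074 row B2; `--supports stmt-BirchSwinnertonDyer-19358 --as helper`)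

HONEST FRAMING. THEOREMS ONLY: no definition, no named fact, no `sorry`, nothing booked; BSD is not proved by any
of this; the crux stays OPEN at class level. The unit-slice theorem of the previous file
(`gordTwoRankOne_unitSlice_of_facts_cmFree`: on every non-CM (G-ord, `e = 2`) pair of analytic rank `1` with
`‖A′‖_p = 1` the lower half holds from published facts alone) and Li–Liu–Tian on the CM rows leave, of the route
decl `GordTwoRankOne`, exactly the CONTENT rows: non-CM pairs with `¬ BranchUnitCoeffAt W p 1`. Two readings:

* `gordTwoRankOne_of_facts_of_contentRows`: `GordTwoRankOne` ⟸ published binders + the crux's own statement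
  DISPLAYED on the content rows (`hContent`, not asserted — the open part of item 19358 after gen 4);
* `gordTwoRankOne_of_parts_contentRows`: gen 2's certified seam `gordTwoRankOne_of_parts` (file `…SplitGlue`)
  with the Λ-adic children (`GordTwoLambdaEven` / `GordTwoLambdaOdd`, items 19497/19498) asked AT THE PAIR and
  ONLY on off-Case-1 content rows in analytic rank `1`; the certificate child (`GordTwoRankOneClassCert`,
  item 19499) unchanged.

NOT claimed: the content rows themselves; the upper half; any booking.

References: [LiLiuTian2024] Thm. 1.1 (i); [Delbourgo2002] Thm. (A), (B); [Disegni2017] Thm. A, B;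
[GreenbergVatsal2000] (3.12); [Wuthrich2014] Thm. 16; [Mazur1972Towers] Cor. 5.15; [MilneADT2006] I.7.3;
[Miller2011LMS] Def. 1.1; cell TARGET.md E68/E74/E90, HOME/k1-c3/CERT-ROADS-19358-g3.md.
-/

set_option autoImplicit false
set_option linter.dupNamespace false

noncomputable section

open scoped Classical MatrixGroups ModularForm NumberField

open CongruenceSubgroup WeierstrassCurve NumberField IsDedekindDomain Field
  Literature.NumberTheory.EllipticCurves Literature.NumberTheory.EllipticCurves.ModularForms
  Literature.NumberTheory.EllipticCurves.GreenbergVatsal2000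
  Literature.NumberTheory.EllipticCurves.Rank1Residual
  Literature.NumberTheory.EllipticCurves.Rank1Residual.Typed
  Literature.NumberTheory.EllipticCurves.Delbourgo2002
  Literature.NumberTheory.EllipticCurves.Disegni2017
  Literature.NumberTheory.GaloisRepresentations
  Summit.BirchSwinnertonDyer.Rank1Residual.AdditivePotMult
  Summit.BirchSwinnertonDyer.Rank1Residual.Additive
  Summit.BirchSwinnertonDyer.BirchSwinnertonDyer.Theses.AdditiveBranchIMC

namespace Summit.BirchSwinnertonDyer.BirchSwinnertonDyer.Theorems.AdditiveBranchIMCGordTwoRankOne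

/-- **CRUX `GordTwoRankOne` BY NAME, REDUCED TO ITS CONTENT ROWS.** GRANTED the crux's own statement on the rows
where the certificate FAILS — non-CM pairs of the cell in analytic rank `1` with `¬ BranchUnitCoeffAt W p 1`,
i.e. `v_p(A′) ≥ 1` (the rows where the Λ-adic children `GordTwoLambdaEven`/`GordTwoLambdaOdd` carry content) or
`A′ = 0` (the rows the certificate child `GordTwoRankOneClassCert` excludes) — the route decl `GordTwoRankOne`
follows from the published binders. `hContent` is DISPLAYED, not asserted: it is exactly the open part of item
19358 after this file. [cite: LiLiuTian2024, Thm. 1.1 (i)] [cite: Delbourgo2002, Theorem (A), (B) (p. 40)]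
[cite: Disegni2017, Theorem A/B] [cite: Mazur1972Towers, Cor. 5.15] [cite: Miller2011LMS, Def. 1.1] -/
theorem gordTwoRankOne_of_facts_of_contentRows
    (hMaz : Mazur1972.cor515_universalNormIndex) (hCyc : delbourgoDatum_cycLineGrossZagier)
    (hCyc3 : delbourgoDatum_cycLineGrossZagier_intrinsicThree)
    (hArt : rankinSelbergEulerProductHecke_baseChangeDirichlet_eq) (h73 : GrossZagier1986_thm_I_7_3)
    (hWald : waldspurger_exists_heegnerField_twist_ne_zero) (hDel : Delbourgo2002.mainTheorem)
    (hDel3 : Delbourgo2002.mainTheorem_three)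
    (hmod : hasEntireLFunction_rat) (hmodD : nonempty_modularParametrizationData)
    (hmodN : exists_isNewformOf) (hGZK : rank_eq_analyticRank_of_analyticRank_le_one)
    (hLLT : LiLiuTian2024.thm11_bsdp_of_cm_rank_one)
    (hContent : ∀ (W : WeierstrassCurve ℚ) [W.IsElliptic] [W.IsGloballyMinimal] (p : ℕ) [Fact p.Prime],
      W.analyticRank = 1 → N10.CellGordTwo W p → ¬ W.HasCM → ¬ BranchUnitCoeffAt W p 1 →
      MissingLowerBoundAt W p) :
    GordTwoRankOne := by
  intro W _ _ p _ hr hc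
  by_cases hcm : W.HasCM
  · exact gordTwoRankOne_cm_of_liLiuTian hLLT W p hr hc hcm
  by_cases hunit : BranchUnitCoeffAt W p 1
  · exact gordTwoRankOne_unitSlice_of_facts_cmFree hMaz hCyc hCyc3 hArt h73 hWald hDel hDel3 hmod hmodD hmodN
      hGZK W p hr hc hcm hunit
  · exact hContent W p hr hc hcm hunit

/-- **The CERTIFIED SEAM of the split (gen 2's `gordTwoRankOne_of_parts`) with the Λ-adic children ASKED ONLY
ON CONTENT ROWS.** From `PrintedFacts`, `ReadingFacts`, the ten by-name leaves and `hLLT` as there, the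
certificate child `hCert` unchanged (`A′ ≠ 0` on every non-CM pair of the cell in analytic rank `1`), and the
branch lower containments `hΛc` (plus, `p ≡ 1 (mod 4)`) / `hΛc'` (minus, `p ≡ 3 (mod 4)`, `p = 3` included) asked
AT THE PAIR and ONLY on off-Case-1, non-CM, analytic-rank-`1` rows with `¬ BranchUnitCoeffAt W p 1` — the route
decl `GordTwoRankOne` follows BY NAME. So in rank one the crux consumes the children `GordTwoLambdaEven` /
`GordTwoLambdaOdd` (items 19497/19498: rank-free, every off-Case-1 row) only through their content rows. Roads:
CM → LLT; unit slice → §5; Case-1 member → gz's end states ∘ Cassels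
(`gordTwoRankOne_caseOne_of_facts_of_classCert`); off-Case-1 content → gen 0's per-pair cores.
[cite: LiLiuTian2024, Thm. 1.1 (i)] [cite: Delbourgo2002, Theorem (A), (B) (p. 40)] [cite: Disegni2017, Theorem A/B]
[cite: GreenbergVatsal2000, §3 Thm. (3.12) p. 45] [cite: Wuthrich2014, Thm. 16 (p. 397)] [cite: Mazur1972Towers, Cor. 5.15]
[cite: MilneADT2006, Thm. I.7.3] [cite: Miller2011LMS, Def. 1.1] -/
theorem gordTwoRankOne_of_parts_contentRows (hP : PrintedFacts) (hR : ReadingFacts)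
    (hMaz : Mazur1972.cor515_universalNormIndex) (hCyc : delbourgoDatum_cycLineGrossZagier)
    (hCyc3 : delbourgoDatum_cycLineGrossZagier_intrinsicThree)
    (hArt : rankinSelbergEulerProductHecke_baseChangeDirichlet_eq) (h73 : GrossZagier1986_thm_I_7_3)
    (hWald : waldspurger_exists_heegnerField_twist_ne_zero) (hDel : Delbourgo2002.mainTheorem)
    (hDel3 : Delbourgo2002.mainTheorem_three) (hmodN : exists_isNewformOf)
    (hLLT : LiLiuTian2024.thm11_bsdp_of_cm_rank_one)
    (hΛc : ∀ (W : WeierstrassCurve ℚ) [W.IsElliptic] [W.IsGloballyMinimal] (p : ℕ) [Fact p.Prime],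
      W.analyticRank = 1 → N10.CellGordTwo W p → ¬ HasCaseOneMember W p → ¬ W.HasCM →
      ¬ BranchUnitCoeffAt W p 1 → p % 4 = 1 → ChiBranchLowerDivisibilityAt W p)
    (hΛc' : ∀ (W : WeierstrassCurve ℚ) [W.IsElliptic] [W.IsGloballyMinimal] (p : ℕ) [Fact p.Prime],
      W.analyticRank = 1 → N10.CellGordTwo W p → ¬ HasCaseOneMember W p → ¬ W.HasCM →
      ¬ BranchUnitCoeffAt W p 1 → p % 4 = 3 → ChiBranchLowerDivisibilityOddAt W p)
    (hCert : ∀ (W : WeierstrassCurve ℚ) [W.IsElliptic] [W.IsGloballyMinimal] (p : ℕ) [Fact p.Prime],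
      W.analyticRank = 1 → N10.CellGordTwo W p → ¬ W.HasCM → BranchCoeffOneNeZeroAt W p) :
    GordTwoRankOne := by
  -- adapted from gen 2's `gordTwoRankOne_of_parts_caseSplit` (file `…SplitGlue`), one case added
  obtain ⟨h23, h414, hGrK, -, hGZK, hmod, hmodD, hCassels⟩ := hP
  obtain ⟨hW16, hGV, hLiftF, hLiftE, -⟩ := hR
  intro W _ _ p _ hr hc
  by_cases hcm : W.HasCM
  · exact gordTwoRankOne_cm_of_liLiuTian hLLT W p hr hc hcm
  by_cases hunit : BranchUnitCoeffAt W p 1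
  · exact gordTwoRankOne_unitSlice_of_facts_cmFree hMaz hCyc hCyc3 hArt h73 hWald hDel hDel3 hmod hmodD hmodN
      hGZK W p hr hc hcm hunit
  by_cases hm : HasCaseOneMember W p
  · exact gordTwoRankOne_caseOne_of_facts_of_classCert hW16 hGV h23 h414 hGrK hLiftF hLiftE hMaz hCyc hCyc3
      hArt h73 hWald hDel hDel3 hmod hmodD hmodN hGZK hCassels W p hr hc hcm
      (classCert_of_forall_branchCoeffOneNeZeroAt hCert hr hc hcm) hm
  · have hne : BranchCoeffOneNeZeroAt W p := hCert W p hr hc hcm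
    by_cases hp3 : p = 3
    · subst hp3
      exact cellGordTwo_missingLowerBoundAt_rankOne_three_intrinsic_of_facts_of_chiBranchLowerOdd_of_branchCoeffOneNeZero
        hMaz hCyc3 hArt h73 hWald hDel3 hmod hmodD hmodN hGZK hc hcm hr (hΛc' W 3 hr hc hm hcm hunit rfl) hne
    · have hp5 : 5 ≤ p := (Fact.out : p.Prime).five_le_of_ne_two_of_ne_three hc.1 hp3
      have hodd : p % 4 = 1 ∨ p % 4 = 3 := by
        obtain ⟨k, hk⟩ := (Fact.out : p.Prime).odd_of_ne_two hc.1
        omega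
      rcases hodd with h1 | h3
      · exact cellGordTwo_missingLowerBoundAt_rankOne_of_facts_of_chiBranchLower_of_branchCoeffOneNeZero hMaz hCyc
          hArt h73 hWald hDel hmod hmodD hmodN hGZK hc h1 hcm hr (hΛc W p hr hc hm hcm hunit h1) hne
      · exact cellGordTwo_missingLowerBoundAt_rankOne_odd_of_facts_of_chiBranchLowerOdd_of_branchCoeffOneNeZero
          hMaz hCyc hArt h73 hWald hDel hmod hmodD hmodN hGZK hc h3 hp5 hcm hr (hΛc' W p hr hc hm hcm hunit h3)
          hne

end Summit.BirchSwinnertonDyer.BirchSwinnertonDyer.Theorems.AdditiveBranchIMCGordTwoRankOne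

end
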